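import Summits.ValiantsHypothesis.ValiantsHypothesis.Theorems.KPlusLogSqLawTropicalBWalkDesignTerms

/-!
# Route `KPlusLogSqLaw`, crux `TropicalB` — walk designs, Ib: SIGN and WEIGHT of a walk term, the identity term

HONEST FRAMING.  Helper file (negative-side calibration) toward the registered stubs `stub_tropThin` / `stub_tropFat` of
`Cruxes/TropicalB/Lines/birth.lean` (crux `TropicalB`, ledger item `stmt-ValiantsHypothesis-19771`, route `KPlusLogSqLaw`,
DRAFT; cell `pub-symmetroid`, seat `val-sym-trop-p1`, 2026-08-26).  Nothing here proves any part of a stub; nothing asserts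
`TropicalB`, `KPlusLogSqLaw`, `MatrixDescartes` or anything about `VP ≠ VNP`.

Continuation of …TropicalBWalkDesignTerms (split for the 400-line rule): for a walk `y` of the walk design
(`…TropicalBWalkDesignDefs`), on `Fin m` along the index equivalence `ι`,
* `termSign_walkTerm = (−1)^T · walkSgnFin lay y` (so the walk term is present, and consecutive walk terms alternate iff
  their edge-sign products do), `tropWeight_walkTerm = (m − T)·(θ·d l₀) + Ω − walkCostFin d lay θ y`;
* `termSign_idTerm = 1`, `tropWeight_idTerm = m·(θ·d l₀)`.
All [folklore].
-/

set_option linter.dupNamespace false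
set_option autoImplicit false

namespace Summit.ValiantsHypothesis.ValiantsHypothesis.Theorems.KPlusLogSqLaw.WalkDesign

open Summit.ValiantsHypothesis.ValiantsHypothesis.Theorems.MatrixDescartes.Negative
open Summit.ValiantsHypothesis.ValiantsHypothesis.Theorems.SymmetroidDescartes.DPR
open scoped BigOperators
open Finset

variable {V : Type*} {T K : ℕ}

/-! ## 3. The walk term and the identity term on `Fin m` -/

/-- the format of the walk design: `m = (T+1)·|V|`. -/
theorem card_eq_of_equiv [Fintype V] {m : ℕ} (ι : Fin (T + 1) × V ≃ Fin m) : (T + 1) * Fintype.card V = m := by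
  have := Fintype.card_congr ι
  simpa [Fintype.card_prod, Fintype.card_fin] using this

/-- the edge of layer `s` along a walk exists. -/
theorem edgeAt_isSome_of_walk {lay : Fin T → V → V → Option (WEdge K)} {v₀ : V} {y : Fin (T + 1) → V}
    (hy : IsLayWalk lay v₀ y) (s : Fin T) : ∃ e, edgeAt lay y s = some e :=
  Option.isSome_iff_exists.mp (hy.2 s)

section Cls

variable [DecidableEq V] (lay : Fin T → V → V → Option (WEdge K)) (l₀ : Fin K)

/-- the class map of a walk term off the cycle points of positive layer is `l₀`. -/
theorem walkClsP_of_not {y : Fin (T + 1) → V} {c : Fin (T + 1) × V} (h : ¬ (c.2 = y c.1 ∧ c.1 ≠ 0)) :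
    walkClsP lay l₀ y c = l₀ := by
  unfold walkClsP; rw [dif_neg h]

/-- the class map of a walk term at the cycle point `(s+1, y (s+1))` is the class of the edge of layer `s`. -/
theorem walkClsP_succ {y : Fin (T + 1) → V} (s : Fin T) {e : WEdge K} (he : edgeAt lay y s = some e) :
    walkClsP lay l₀ y (s.succ, y s.succ) = e.cls := by
  unfold walkClsP
  have h : (y s.succ = y (s.succ) ∧ (s.succ : Fin (T + 1)) ≠ 0) := ⟨rfl, Fin.succ_ne_zero s⟩
  rw [dif_pos h]
  simp only [Fin.pred_succ]
  rw [he]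

/-- the class map at `(0, y 0)` is `l₀`. -/
theorem walkClsP_zero {y : Fin (T + 1) → V} : walkClsP lay l₀ y (0, y 0) = l₀ :=
  walkClsP_of_not lay l₀ (by simp)

variable (Ω : ℤ) (v₀ : V) (d : Fin K → ℕ) (θ : ℤ)

/-- per-pair sign factor of the walk term: `1` off the cycle, `1` at the back step, the edge sign at a layer step. -/
theorem epsFactor_walk (hT : 0 < T) {y : Fin (T + 1) → V} (hy : IsLayWalk lay v₀ y) (i : Fin (T + 1) × V) :
    walkEpsP lay l₀ v₀ (walkPerm y i) i (walkClsP lay l₀ y i) =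
      if i.2 = y i.1 then (if h : i.1 = 0 then 1 else
        match edgeAt lay y (i.1.pred h) with | some e => e.sgn | none => 1) else 1 := by
  by_cases hc : i.2 = y i.1
  · rw [if_pos hc]
    obtain ⟨t, x⟩ := i
    simp only at hc
    subst hc
    by_cases ht : t = 0
    · subst ht
      rw [dif_pos rfl, walkPerm_zero, walkClsP_zero, hy.1, walkEpsP_back lay l₀ v₀ hT]
      simp
    · rw [dif_neg ht]
      obtain ⟨s, rfl⟩ : ∃ s : Fin T, t = s.succ := ⟨t.pred ht, (Fin.succ_pred t ht).symm⟩
      obtain ⟨e, he⟩ := edgeAt_isSome_of_walk hy s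
      simp only [Fin.pred_succ]
      rw [he, walkPerm_succ, walkClsP_succ lay l₀ s he]
      have hrc : ((s.castSucc, y s.castSucc) : Fin (T + 1) × V) ≠ (s.succ, y s.succ) := by
        intro h; have := congrArg (fun p : Fin (T + 1) × V => p.1.val) h; simp at this
      rw [walkEpsP_layer lay l₀ v₀ hrc (by rw [layerEdge_succ]; exact he)]
      simp
  · rw [if_neg hc, walkPerm_apply_of_ne y hc, walkClsP_of_not lay l₀ (fun h => hc h.1), walkEpsP_self]
    simp

/-- per-pair weight of the walk term: `θ·d l₀` off the cycle, `θ·d l₀ + Ω` at the back step, `θ·d cls − a` at a layer step. -/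
theorem weightTerm_walk (hT : 0 < T) {y : Fin (T + 1) → V} (hy : IsLayWalk lay v₀ y) (i : Fin (T + 1) × V) :
    θ * (d (walkClsP lay l₀ y i) : ℤ) - walkValP lay Ω v₀ (walkPerm y i) i (walkClsP lay l₀ y i) =
      if i.2 = y i.1 then (if h : i.1 = 0 then θ * (d l₀ : ℤ) + Ω else
        match edgeAt lay y (i.1.pred h) with | some e => θ * (d e.cls : ℤ) - e.a | none => 0)
      else θ * (d l₀ : ℤ) := by
  by_cases hc : i.2 = y i.1
  · rw [if_pos hc]
    obtain ⟨t, x⟩ := i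
    simp only at hc
    subst hc
    by_cases ht : t = 0
    · subst ht
      rw [dif_pos rfl, walkPerm_zero, walkClsP_zero, hy.1, walkValP_back lay Ω v₀ hT]
      ring
    · rw [dif_neg ht]
      obtain ⟨s, rfl⟩ : ∃ s : Fin T, t = s.succ := ⟨t.pred ht, (Fin.succ_pred t ht).symm⟩
      obtain ⟨e, he⟩ := edgeAt_isSome_of_walk hy s
      simp only [Fin.pred_succ]
      rw [he, walkPerm_succ, walkClsP_succ lay l₀ s he]
      have hrc : ((s.castSucc, y s.castSucc) : Fin (T + 1) × V) ≠ (s.succ, y s.succ) := by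
        intro h; have := congrArg (fun p : Fin (T + 1) × V => p.1.val) h; simp at this
      rw [walkValP_layer lay Ω v₀ hrc (by rw [layerEdge_succ]; exact he)]
  · rw [if_neg hc, walkPerm_apply_of_ne y hc, walkClsP_of_not lay l₀ (fun h => hc h.1), walkValP_self]
    ring

end Cls

section Sums

variable [Fintype V] [DecidableEq V]

/-- a sum over pairs concentrated on the cycle points plus a constant elsewhere. -/
theorem sum_cycle_add_const (F : Fin (T + 1) × V → ℤ) (G : Fin (T + 1) → ℤ) (C : ℤ) (y : Fin (T + 1) → V)
    (hF : ∀ i, F i = if i.2 = y i.1 then G i.1 else C) :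
    ∑ i, F i = ∑ t, G t + ((T + 1 : ℕ) * (Fintype.card V - 1 : ℤ)) * C := by
  rw [Fintype.sum_prod_type]
  have hV : 1 ≤ Fintype.card V := Fintype.card_pos_iff.mpr ⟨y 0⟩
  have hrow : ∀ t : Fin (T + 1), ∑ x, F (t, x) = G t + (Fintype.card V - 1 : ℤ) * C := by
    intro t
    rw [← Finset.add_sum_erase _ _ (mem_univ (y t))]
    have h1 : F (t, y t) = G t := by rw [hF]; exact if_pos rfl
    have h2 : ∑ x ∈ univ.erase (y t), F (t, x) = ∑ _x ∈ univ.erase (y t), C :=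
      Finset.sum_congr rfl (fun x hx => by rw [hF]; exact if_neg (Finset.ne_of_mem_erase hx))
    rw [h1, h2, sum_const, card_erase_of_mem (mem_univ _), card_univ, nsmul_eq_mul, Nat.cast_sub hV,
      Nat.cast_one]
  simp_rw [hrow]
  rw [sum_add_distrib, sum_const, card_univ, Fintype.card_fin, nsmul_eq_mul]
  push_cast
  ring

/-- a product over pairs concentrated on the cycle points, `1` elsewhere. -/
theorem prod_cycle_one (F : Fin (T + 1) × V → ℤ) (G : Fin (T + 1) → ℤ) (y : Fin (T + 1) → V)
    (hF : ∀ i, F i = if i.2 = y i.1 then G i.1 else 1) : ∏ i, F i = ∏ t, G t := by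
  rw [Fintype.prod_prod_type]
  refine Fintype.prod_congr _ _ fun t => ?_
  rw [Finset.prod_eq_single (y t)]
  · rw [hF]; exact if_pos rfl
  · intro x _ hx; rw [hF]; exact if_neg hx
  · intro h; exact absurd (mem_univ _) h

end Sums

section Term

variable [Fintype V] [DecidableEq V] {m : ℕ} (ι : Fin (T + 1) × V ≃ Fin m) (d : Fin K → ℕ)
  (lay : Fin T → V → V → Option (WEdge K)) (l₀ : Fin K) (Ω : ℤ) (v₀ : V) (θ : ℤ)

/-- **Sign of the walk term**: `(−1)^T` times the product of the edge signs. -/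
theorem termSign_walkTerm (hT : 0 < T) {y : Fin (T + 1) → V} (hy : IsLayWalk lay v₀ y) :
    termSign (walkEps ι lay l₀ v₀) (walkTerm ι lay l₀ y) = (-1) ^ T * walkSgnFin lay y := by
  unfold termSign walkTerm walkEps
  simp only
  rw [Equiv.Perm.sign_symm_trans_trans, sign_walkPerm y hT]
  have hprod : ∏ c : Fin m, walkEpsP lay l₀ v₀ (ι.symm (((ι.symm.trans (walkPerm y)).trans ι) c)) (ι.symm c)
      (walkClsP lay l₀ y (ι.symm c)) = ∏ i, walkEpsP lay l₀ v₀ (walkPerm y i) i (walkClsP lay l₀ y i) := by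
    refine Fintype.prod_equiv ι.symm _ _ (fun c => ?_)
    simp
  set G : Fin (T + 1) → ℤ := fun t => if h : t = 0 then 1 else
      match edgeAt lay y (t.pred h) with | some e => e.sgn | none => 1 with hG
  have hG0 : G 0 = 1 := by simp [hG]
  have hGs : ∀ s : Fin T, G s.succ = (match edgeAt lay y s with | some e => e.sgn | none => 1) := by
    intro s; simp [hG, Fin.succ_ne_zero]
  rw [hprod, prod_cycle_one _ G y (fun i => epsFactor_walk lay l₀ v₀ hT hy i), Fin.prod_univ_succ, hG0, one_mul]
  unfold walkSgnFin
  rw [Finset.prod_congr rfl (fun s _ => hGs s)]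
  try rfl

/-- **Weight of the walk term**: `(m − T)·(θ·d l₀) + Ω − walkCostFin`. -/
theorem tropWeight_walkTerm (hT : 0 < T) {y : Fin (T + 1) → V} (hy : IsLayWalk lay v₀ y) :
    tropWeight d (walkVal ι lay Ω v₀) θ (walkTerm ι lay l₀ y) =
      ((m : ℤ) - T) * (θ * (d l₀ : ℤ)) + Ω - walkCostFin d lay θ y := by
  unfold tropWeight walkTerm walkVal
  simp only
  rw [Finset.mul_sum, ← Finset.sum_sub_distrib]
  have hsum : ∑ c : Fin m, (θ * (d (walkClsP lay l₀ y (ι.symm c)) : ℤ) -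
      walkValP lay Ω v₀ (ι.symm (((ι.symm.trans (walkPerm y)).trans ι) c)) (ι.symm c) (walkClsP lay l₀ y (ι.symm c)))
      = ∑ i, (θ * (d (walkClsP lay l₀ y i) : ℤ) - walkValP lay Ω v₀ (walkPerm y i) i (walkClsP lay l₀ y i)) := by
    refine Fintype.sum_equiv ι.symm _ _ (fun c => ?_)
    simp
  set G : Fin (T + 1) → ℤ := fun t => if h : t = 0 then θ * (d l₀ : ℤ) + Ω else
      match edgeAt lay y (t.pred h) with | some e => θ * (d e.cls : ℤ) - e.a | none => 0 with hG
  have hG0 : G 0 = θ * (d l₀ : ℤ) + Ω := by simp [hG]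
  have hGs : ∀ s : Fin T, G s.succ = (match edgeAt lay y s with | some e => θ * (d e.cls : ℤ) - e.a | none => 0) := by
    intro s; simp [hG, Fin.succ_ne_zero]
  rw [hsum, sum_cycle_add_const _ G (θ * (d l₀ : ℤ)) y (fun i => weightTerm_walk lay l₀ Ω v₀ d θ hT hy i),
    Fin.sum_univ_succ, hG0, Finset.sum_congr rfl (fun s _ => hGs s)]
  have hneg : ∑ s : Fin T, (match edgeAt lay y s with | some e => θ * (d e.cls : ℤ) - e.a | none => 0) =
      - walkCostFin d lay θ y := by
    unfold walkCostFin
    rw [← Finset.sum_neg_distrib]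
    refine Finset.sum_congr rfl fun s _ => ?_
    cases edgeAt lay y s with
    | none => simp
    | some e => simp only; ring
  rw [hneg, ← card_eq_of_equiv ι]
  push_cast
  ring

/-- the walk term is present. -/
theorem termSign_walkTerm_ne_zero (hT : 0 < T) {y : Fin (T + 1) → V} (hy : IsLayWalk lay v₀ y) :
    termSign (walkEps ι lay l₀ v₀) (walkTerm ι lay l₀ y) ≠ 0 := by
  rw [termSign_walkTerm ι lay l₀ v₀ hT hy]
  refine mul_ne_zero (pow_ne_zero _ (by norm_num)) ?_
  unfold walkSgnFin
  rw [Finset.prod_ne_zero_iff]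
  intro s _
  cases edgeAt lay y s with
  | none => simp
  | some e => simp only [WEdge.sgn]; split_ifs <;> norm_num

omit [Fintype V] in
/-- the identity term is present with sign `1`. -/
theorem termSign_idTerm : termSign (walkEps ι lay l₀ v₀) (idTerm (m := m) l₀) = 1 := by
  unfold termSign idTerm walkEps
  simp only [Equiv.Perm.sign_one, Units.val_one, one_mul, Equiv.Perm.one_apply]
  exact Finset.prod_eq_one fun c _ => by rw [walkEpsP_self]; exact if_pos rfl

omit [Fintype V] in
/-- weight of the identity term: `m·(θ·d l₀)`. -/
theorem tropWeight_idTerm :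
    tropWeight d (walkVal ι lay Ω v₀) θ (idTerm (m := m) l₀) = (m : ℤ) * (θ * (d l₀ : ℤ)) := by
  unfold tropWeight idTerm walkVal
  simp only [Equiv.Perm.one_apply, walkValP_self, sum_const_zero, sub_zero, sum_const, card_univ,
    Fintype.card_fin, nsmul_eq_mul]
  ring

end Term

end Summit.ValiantsHypothesis.ValiantsHypothesis.Theorems.KPlusLogSqLaw.WalkDesign
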